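/-
Origin: expansion seat `planner-pub-hodgecm-mc-axioms-1-g14-0`, handover #W229 2026-08-20T15:53:55Z md5 e1e83f1d863a (PKG e3fd3ef37930 → e1e83f1d863a; 198 l.; MECHANICAL (iib-R) rewrite v3.1 of the PKG file as it stands (13 token edits; rules R1x1+RX[h₂]x12)) (`HOME/mc/pub-hodgecm-mc-axioms-1-g14/revendor/kit-r55/stage55/HodgeCM/Model/Binders/Real34CensusTAssembly.lean`, md5 e1e83f1d863a, 198 lines);
landed by the gen-22 packager (p-g22) in gate run 55 REPLACES the earlier landed copy of `HodgeCM/Model/Binders/Real34CensusTAssembly.lean` (seat copy carried the packager Origin header of an earlier run (stripped)).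
-/
/-
Origin: speedrun cell pub-hodgecm, MODEL-CONSTRUCTION sub-cell, unit pub-hodgecm-mc-binder-1-g11 (BINDER PROVER, gen 11; row 15: the census-T
record ASSEMBLED from eigenletters), seat prover-pub-hodgecm-mc-binder-1-g11-0, 2026-08-20.  Target in PKG:
HodgeCM/Model/Binders/Real34CensusTAssembly.lean (NEW additive leaf; imports #41 `Binders/Real34PinsCensusT` + `Binders/Real34TorusZero`).
KERNEL ONLY: 1 theorem + 1 def-valued constructor; 0 records, nothing cited, 0 `def … : Prop`, MODEL-N ±0, E unchanged.
Nothing here is a claim of the manuscripts under adjudication.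
-/
import Summits.HodgeConjecture.HodgeCM.Model.Binders.Real34PinsCensusT
import Summits.HodgeConjecture.HodgeCM.Model.Binders.Real34TorusZero

/-!
# `Real34CensusSideT` from EIGENLETTERS: row 15's residual is «matched printed pure tensors are admissible wedge sums»

For mc-binder-2's (34) census core `core` of a good context (at the pins `W := Gen12Pins.Wg …`, `S := SInstance.SGP …`):

* § 1 `span_tprod_of_span_eq_top` — if every local module `M_b` is spanned by a set `E_b`, the pure tensors `⨂ₜ m` with `m_b ∈ E_b`
  span `⨂[ℂ] b, M_b` (multilinearity, one coordinate at a time);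
* § 2 **`Real34CensusSideT.ofEigenletters core hspan hmatched`** — the record from: (E) every local module is spanned by torus eigenvectors
  (`hspan`, binder-2's letters), and (W) every MATCHED eigen pure tensor (`∀ t, (∏ cχ b (t b)) · χ([ιc t]) = 1`) is an admissible wedge sum of
  the guarded S pin (`hmatched` — THE residual: (W-ι₁) + (W-fin) + (HW-T3) + (HW-T3′) of `K34-HWEDGE.md` §3).
-/

set_option autoImplicit false

noncomputable section

open MeasureTheory NumberField MulAction
open scoped Matrix InnerProductSpace TensorProduct

attribute [-instance] Quotient.instMeasurableSpace

namespace HodgeCM.Model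

open HodgeCM HodgeCM.Universe HodgeCM.Adelic HodgeCM.Model.HypCensus
open HodgeCM.PerL34 HodgeCM.PerL34.Fock HodgeCM.PerL34.Fock.PrintDict HodgeCM.PerL34.Annihilation
open Literature.NumberTheory.Weil1964
open Literature.NumberTheory.Automorphic (piSchwartzBruhat)
open Literature.NumberTheory.GelbartRogawski1991.UnitaryDualPair
open Literature.AlgebraicGeometry.HodgeTheory
open Literature.NumberTheory.Automorphic.PicardCM
open Literature.NumberTheory.Transcendental (Arapura2012_Cor_15_4_6)
open HodgeCM.Model.ThetaSpace
open HodgeCM.Model.ArchSideTerm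
open NumberField.SeesawArchTorus (toAdeles printedTorusHom printedTorusHom_apply placesEquiv)

/-! ## 1. Pure tensors of spanning families span the tensor product -/

/-- If `E b` spans `M b` for every `b`, the pure tensors with components in the `E b` span `⨂[ℂ] b, M b`. -/
theorem span_tprod_of_span_eq_top {ιb : Type*} [Fintype ιb] [DecidableEq ιb] {M : ιb → Type*}
    [∀ b, AddCommGroup (M b)] [∀ b, Module ℂ (M b)] (E : ∀ b, Set (M b)) (hE : ∀ b, Submodule.span ℂ (E b) = ⊤) :
    Submodule.span ℂ {x : ⨂[ℂ] b, M b | ∃ m : ∀ b, M b, (∀ b, m b ∈ E b) ∧ x = PiTensorProduct.tprod ℂ m} = ⊤ := by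
  set N := Submodule.span ℂ {x : ⨂[ℂ] b, M b | ∃ m : ∀ b, M b, (∀ b, m b ∈ E b) ∧ x = PiTensorProduct.tprod ℂ m} with hN
  -- Q s : every pure tensor whose components OUTSIDE `s` lie in the `E b` is in `N`
  have key : ∀ s : Finset ιb, ∀ m : ∀ b, M b, (∀ b, b ∉ s → m b ∈ E b) → PiTensorProduct.tprod ℂ m ∈ N := by
    intro s
    induction s using Finset.induction_on with
    | empty => exact fun m hm => Submodule.subset_span ⟨m, fun b => hm b (Finset.notMem_empty b), rfl⟩
    | @insert j s hj ih =>
      intro m hm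
      -- vary the `j`-th coordinate linearly
      have hle : Submodule.span ℂ (E j) ≤ N.comap ((PiTensorProduct.tprod ℂ : MultilinearMap ℂ M (⨂[ℂ] b, M b)).toLinearMap m j) := by
        refine Submodule.span_le.2 fun v hv => ?_
        change PiTensorProduct.tprod ℂ (Function.update m j v) ∈ N
        refine ih _ fun b hb => ?_
        by_cases hbj : b = j
        · subst hbj; rw [Function.update_self]; exact hv
        · rw [Function.update_of_ne hbj]; exact hm b (by rw [Finset.mem_insert, not_or]; exact ⟨hbj, hb⟩)
      have hmj : m j ∈ Submodule.span ℂ (E j) := by rw [hE j]; exact Submodule.mem_top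
      have := hle hmj
      rw [Submodule.mem_comap, MultilinearMap.toLinearMap_apply, Function.update_eq_self] at this
      exact this
  rw [eq_top_iff, ← PiTensorProduct.span_tprod_eq_top, Submodule.span_le]
  rintro _ ⟨m, rfl⟩
  exact key Finset.univ m fun b hb => absurd (Finset.mem_univ b) hb

namespace Gen12PinsP

variable
  (G : ∀ {L : CMField} {ι₁ : L →+* ℂ} (_V : HermSpace3 L ι₁) (_c : SeesawCtx L), Prop)
  (hG : ∀ {L : CMField} {ι₁ : L →+* ℂ} (V : HermSpace3 L ι₁) (c : SeesawCtx L),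
    G V c → (∀ j, 0 < (ι₁ (dW c.D j)).re) ∨ ∀ j, (ι₁ (dW c.D j)).re < 0)
  (hGR : ∀ {L : CMField} {ι₁ : L →+* ℂ} (V : HermSpace3 L ι₁) (c : SeesawCtx L),
    (cmSplittingDatum (L : Type) finProdFinEquiv (frameD V) (frameD_real V) (frameD_ne V) (dW c.D) (dW_real c.D)
      (dW_ne c.D)).CompatibleSplitting)
  (η : ∀ {L : CMField} {ι₁ : L →+* ℂ} (V : HermSpace3 L ι₁) (c : SeesawCtx L),
    CMAdelic (L : Type) (frameD V) × CMAdelic (L : Type) (dW c.D) →* ℂˣ)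
  (hη : ∀ {L : CMField} {ι₁ : L →+* ℂ} (V : HermSpace3 L ι₁) (c : SeesawCtx L),
    ∀ γU ∈ CMRat (L : Type) (frameD V), ∀ γ ∈ CMRat (L : Type) (dW c.D), η V c (γU, γ) = 1)
  (hηc : ∀ {L : CMField} {ι₁ : L →+* ℂ} (V : HermSpace3 L ι₁) (c : SeesawCtx L), Continuous fun p => ((η V c p : ℂˣ) : ℂ))
  (hGR₀ : ∀ {L : CMField} {ι₁ : L →+* ℂ} (V : HermSpace3 L ι₁) (c : SeesawCtx L),
    (cmSplittingDatum (L : Type) (e₁) (frameD V) (frameD_real V) (frameD_ne V) (lineVec (L : Type) (dW c.D 0))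
      (fun _ => dW_real c.D 0) (fun _ => dW_ne c.D 0)).CompatibleSplitting)
  (hGR₁ : ∀ {L : CMField} {ι₁ : L →+* ℂ} (V : HermSpace3 L ι₁) (c : SeesawCtx L),
    (cmSplittingDatum (L : Type) (e₁) (frameD V) (frameD_real V) (frameD_ne V) (lineVec (L : Type) (dW c.D 1))
      (fun _ => dW_real c.D 1) (fun _ => dW_ne c.D 1)).CompatibleSplitting)
  (hGR₂ : ∀ {L : CMField} {ι₁ : L →+* ℂ} (V : HermSpace3 L ι₁) (c : SeesawCtx L),
    (cmSplittingDatum (L : Type) (e₁) (frameD V) (frameD_real V) (frameD_ne V) (lineVec (L : Type) (dW' c.D 0))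
      (fun _ => dW'_real c.D 0) (fun _ => dW'_ne c.D 0)).CompatibleSplitting)
  (hGR₃ : ∀ {L : CMField} {ι₁ : L →+* ℂ} (V : HermSpace3 L ι₁) (c : SeesawCtx L),
    (cmSplittingDatum (L : Type) (e₁) (frameD V) (frameD_real V) (frameD_ne V) (lineVec (L : Type) (dW' c.D 1))
      (fun _ => dW'_real c.D 1) (fun _ => dW'_ne c.D 1)).CompatibleSplitting)
  (AG : ∀ {L : CMField} {ι₁ : L →+* ℂ} (V : HermSpace3 L ι₁) (c : SeesawCtx L), G V c → ∀ k : Fin 4,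
    ArchLineInput V (lineRepD V c.D (hGR V c) (hGR₀ V c) (hGR₁ V c) (hGR₂ V c) (hGR₃ V c) (η V c) k))

variable (hHD : exists_isReal_hodgeModel) (hI : hodgePQ_independent_of_hodgeModel)
  (h₁ : BallQuotientUniformised)  (h₃ : CMAbelianVarietyRealised)
  (h : Bool) (hA : Arapura2012_Cor_15_4_6) (μ : ∀ {L : CMField}, SeesawCtx L → Fin 4 → InfinitePlace L → ℤ)

section Context34

variable {L : CMField} {ι₁ : L →+* ℂ} (V : HermSpace3 L ι₁) (c : SeesawCtx L) (hV : IsAnisotropic L V.Hm)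

/-! ## 2. The census-T record from eigenletters -/

/-- **`Real34CensusSideT` FROM EIGENLETTERS.**  Given binder-2's (34) census core at the W pin, (E) `hspan`: every local printed module is
spanned by its torus eigenvectors, and (W) `hmatched`: every printed pure tensor of eigenletters whose product character MATCHES `χ_∞⁻¹` on
`T₃₄(ℝ)` is inserted (by `ins f`) into the span of the single admissible (34) wedges of the guarded S pin — the record holds: the set of
printed vectors satisfying `hwedgeT` is linear (linearity of `insM f`, of `ϑ₃₄(χ, ·)` — #30 § 1 — and of `admWedgeSpan`), eigen pure
tensors span (§ 1), a printed pure tensor of eigenletters is a `T₃₄(ℝ)`-eigenvector of `ρ(1, eW (jT₃₄ ·))` with the product character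
(`core.side.omg_ins` + `Fock.map_tprod_eq_prod_smul`), and the UNMATCHED ones have zero (34) period (`Real34TorusZero.t34_ϑ_eq_zero_of_eigen`). -/
def Real34CensusSideT.ofEigenletters (hW : IsAnisotropic L c.D.gramW)
    (core : HypCoreW ((Gen12Pins.Wg @hGR @η @hη @hηc @Gen12Pins.τSyl @Gen12Pins.TSyl @Gen12Pins.hTSyl) V c) c.D.jT₃₄ (fun w => -μ c 2 w) (fun w => -μ c 3 w))
    (hspan : letI := core.decEq
      ∀ b : InfinitePlace (L : Type),
        Submodule.span ℂ {m : ((printPlaces (InfinitePlace (L : Type)) core.kind core.lam core.hlam (pinnedVacs core.kind (fun w => -μ c 2 w) (fun w => -μ c 3 w))).loc b).M | ∃ cχ : ((printPlaces (InfinitePlace (L : Type)) core.kind core.lam core.hlam (pinnedVacs core.kind (fun w => -μ c 2 w) (fun w => -μ c 3 w))).loc b).T → ℂ, ∀ t, ((printPlaces (InfinitePlace (L : Type)) core.kind core.lam core.hlam (pinnedVacs core.kind (fun w => -μ c 2 w) (fun w => -μ c 3 w))).loc b).ω t m = cχ t • m} = ⊤)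
    (hmatched : letI := core.decEq
      ∀ (χ : ((pinT hHD hI h₁ h₃ h hA (Gen12Pins.Wg @hGR @η @hη @hηc @Gen12Pins.τSyl @Gen12Pins.TSyl @Gen12Pins.hTSyl) (SInstance.SGP @G @hG @hGR @η @hη @hηc @hGR₀ @hGR₁ @hGR₂ @hGR₃ @AG) μ).t34 V c).X) (f : core.side.FinIdx) (m : ∀ b : InfinitePlace (L : Type), ((printPlaces (InfinitePlace (L : Type)) core.kind core.lam core.hlam (pinnedVacs core.kind (fun w => -μ c 2 w) (fun w => -μ c 3 w))).loc b).M)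
        (cχ : ∀ b : InfinitePlace (L : Type), ((printPlaces (InfinitePlace (L : Type)) core.kind core.lam core.hlam (pinnedVacs core.kind (fun w => -μ c 2 w) (fun w => -μ c 3 w))).loc b).T → ℂ),
        (∀ b t, ((printPlaces (InfinitePlace (L : Type)) core.kind core.lam core.hlam (pinnedVacs core.kind (fun w => -μ c 2 w) (fun w => -μ c 3 w))).loc b).ω t (m b) = cχ b t • m b) →
        (∀ t : (printPlaces (InfinitePlace (L : Type)) core.kind core.lam core.hlam (pinnedVacs core.kind (fun w => -μ c 2 w) (fun w => -μ c 3 w))).Tg, (∏ b, cχ b (t b)) * dualChar χ.1 (QuotientGroup.mk (toAdeles (L : Type) ((placesEquiv (L : Type)).symm (placesCoord (InfinitePlace (L : Type)) core.kind core.lam core.hlam (pinnedVacs core.kind (fun w => -μ c 2 w) (fun w => -μ c 3 w)) t)))) = 1) →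
        (core.side.ins f (PiTensorProduct.tprod ℂ m) : piSchwartzBruhat (↥(maximalRealSubfield L)) (Fin 6)) ∈
          admWedgeSpan hHD hI h₁ h₃ ((SInstance.SGP @G @hG @hGR @η @hη @hηc @hGR₀ @hGR₁ @hGR₂ @hGR₃ @AG) V c) hV) :
    Real34CensusSideT @G @hG @hGR @η @hη @hηc @hGR₀ @hGR₁ @hGR₂ @hGR₃ @AG hHD hI h₁ h₃ h hA @μ V c hV := by
  letI := core.decEq
  refine ⟨core, fun χ f φ => ?_⟩
  -- (i) the eigen-relation for printed pure tensors of eigenletters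
  have heig : ∀ (m : ∀ b : InfinitePlace (L : Type), ((printPlaces (InfinitePlace (L : Type)) core.kind core.lam core.hlam (pinnedVacs core.kind (fun w => -μ c 2 w) (fun w => -μ c 3 w))).loc b).M) (cχ : ∀ b : InfinitePlace (L : Type), ((printPlaces (InfinitePlace (L : Type)) core.kind core.lam core.hlam (pinnedVacs core.kind (fun w => -μ c 2 w) (fun w => -μ c 3 w))).loc b).T → ℂ),
      (∀ b t, ((printPlaces (InfinitePlace (L : Type)) core.kind core.lam core.hlam (pinnedVacs core.kind (fun w => -μ c 2 w) (fun w => -μ c 3 w))).loc b).ω t (m b) = cχ b t • m b) → ∀ t : (printPlaces (InfinitePlace (L : Type)) core.kind core.lam core.hlam (pinnedVacs core.kind (fun w => -μ c 2 w) (fun w => -μ c 3 w))).Tg,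
      ((((Gen12Pins.Wg @hGR @η @hη @hηc @Gen12Pins.τSyl @Gen12Pins.TSyl @Gen12Pins.hTSyl) V c).ρ (1, ((Gen12Pins.Wg @hGR @η @hη @hηc @Gen12Pins.τSyl @Gen12Pins.TSyl @Gen12Pins.hTSyl) V c).eW ((c.D.jT₃₄.toMonoidHom.comp (toAdeles (L : Type))) ((placesEquiv (L : Type)).symm (placesCoord (InfinitePlace (L : Type)) core.kind core.lam core.hlam (pinnedVacs core.kind (fun w => -μ c 2 w) (fun w => -μ c 3 w)) t)))) : Module.End ℂ (piSchwartzBruhat ((Gen12Pins.Wg @hGR @η @hη @hηc @Gen12Pins.τSyl @Gen12Pins.TSyl @Gen12Pins.hTSyl) V c).F ((Gen12Pins.Wg @hGR @η @hη @hηc @Gen12Pins.τSyl @Gen12Pins.TSyl @Gen12Pins.hTSyl) V c).ι))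
          (core.side.ins f (PiTensorProduct.tprod ℂ m))) =
        (∏ b, cχ b (t b)) • core.side.ins f (PiTensorProduct.tprod ℂ m) := by
    intro m cχ hm t
    have homg := core.side.omg_ins f t (PiTensorProduct.tprod ℂ m)
    rw [printedTorusHom_apply] at homg
    change (((Gen12Pins.Wg @hGR @η @hη @hηc @Gen12Pins.τSyl @Gen12Pins.TSyl @Gen12Pins.hTSyl) V c).ρ (1, _) : Module.End ℂ (piSchwartzBruhat ((Gen12Pins.Wg @hGR @η @hη @hηc @Gen12Pins.τSyl @Gen12Pins.TSyl @Gen12Pins.hTSyl) V c).F ((Gen12Pins.Wg @hGR @η @hη @hηc @Gen12Pins.τSyl @Gen12Pins.TSyl @Gen12Pins.hTSyl) V c).ι)) _ = _ at homg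
    rw [homg]
    have hω : (printPlaces (InfinitePlace (L : Type)) core.kind core.lam core.hlam (pinnedVacs core.kind (fun w => -μ c 2 w) (fun w => -μ c 3 w))).ωT t (PiTensorProduct.tprod ℂ m) = (∏ b, cχ b (t b)) • PiTensorProduct.tprod ℂ m :=
      map_tprod_eq_prod_smul (fun b => ((printPlaces (InfinitePlace (L : Type)) core.kind core.lam core.hlam (pinnedVacs core.kind (fun w => -μ c 2 w) (fun w => -μ c 3 w))).loc b).ω) cχ m hm t
    rw [hω]
    exact (core.side.ins f).map_smul _ _
  -- (ii) the `hwedgeT` property along the span of the eigen pure tensors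
  have key : ∀ ψ : (printPlaces (InfinitePlace (L : Type)) core.kind core.lam core.hlam (pinnedVacs core.kind (fun w => -μ c 2 w) (fun w => -μ c 3 w))).F,
      ψ ∈ Submodule.span ℂ {x : (printPlaces (InfinitePlace (L : Type)) core.kind core.lam core.hlam (pinnedVacs core.kind (fun w => -μ c 2 w) (fun w => -μ c 3 w))).F | ∃ m : ∀ b, ((printPlaces (InfinitePlace (L : Type)) core.kind core.lam core.hlam (pinnedVacs core.kind (fun w => -μ c 2 w) (fun w => -μ c 3 w))).loc b).M,
        (∀ b, m b ∈ {m' : ((printPlaces (InfinitePlace (L : Type)) core.kind core.lam core.hlam (pinnedVacs core.kind (fun w => -μ c 2 w) (fun w => -μ c 3 w))).loc b).M | ∃ cχ : ((printPlaces (InfinitePlace (L : Type)) core.kind core.lam core.hlam (pinnedVacs core.kind (fun w => -μ c 2 w) (fun w => -μ c 3 w))).loc b).T → ℂ, ∀ t, ((printPlaces (InfinitePlace (L : Type)) core.kind core.lam core.hlam (pinnedVacs core.kind (fun w => -μ c 2 w) (fun w => -μ c 3 w))).loc b).ω t m' = cχ t • m'}) ∧ x = PiTensorProduct.tprod ℂ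 m} →
      ∃ Ψ : ↥((wmOf' printFact_unitaryCompact_holds ((Gen12Pins.Wg @hGR @η @hη @hηc @Gen12Pins.τSyl @Gen12Pins.TSyl @Gen12Pins.hTSyl) V c)).SK),
        (Subtype.val Ψ : piSchwartzBruhat (↥(maximalRealSubfield L)) (Fin 6)) ∈ admWedgeSpan hHD hI h₁ h₃ ((SInstance.SGP @G @hG @hGR @η @hη @hηc @hGR₀ @hGR₁ @hGR₂ @hGR₃ @AG) V c) hV ∧
          ((pinT hHD hI h₁ h₃ h hA (Gen12Pins.Wg @hGR @η @hη @hηc @Gen12Pins.τSyl @Gen12Pins.TSyl @Gen12Pins.hTSyl) (SInstance.SGP @G @hG @hGR @η @hη @hηc @hGR₀ @hGR₁ @hGR₂ @hGR₃ @AG) μ).t34 V c).ϑ χ (insM printFact_unitaryCompact_holds ((Gen12Pins.Wg @hGR @η @hη @hηc @Gen12Pins.τSyl @Gen12Pins.TSyl @Gen12Pins.hTSyl) V c) c.D.jT₃₄ core.kind core.lam core.hlam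
              (fun w => -μ c 2 w) (fun w => -μ c 3 w) core.side f ψ) = ((pinT hHD hI h₁ h₃ h hA (Gen12Pins.Wg @hGR @η @hη @hηc @Gen12Pins.τSyl @Gen12Pins.TSyl @Gen12Pins.hTSyl) (SInstance.SGP @G @hG @hGR @η @hη @hηc @hGR₀ @hGR₁ @hGR₂ @hGR₃ @AG) μ).t34 V c).ϑ χ Ψ := by
    intro ψ hψ
    induction hψ using Submodule.span_induction with
    | mem x hx =>
      obtain ⟨m, hm, rfl⟩ := hx
      choose cχ hcχ using hm
      by_cases hmt : ∀ t : (printPlaces (InfinitePlace (L : Type)) core.kind core.lam core.hlam (pinnedVacs core.kind (fun w => -μ c 2 w) (fun w => -μ c 3 w))).Tg, (∏ b, cχ b (t b)) * dualChar χ.1 (QuotientGroup.mk (toAdeles (L : Type) ((placesEquiv (L : Type)).symm (placesCoord (InfinitePlace (L : Type)) core.kind core.lam core.hlam (pinnedVacs core.kind (fun w => -μ c 2 w) (fun w => -μ c 3 w)) t)))) = 1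
      · -- matched: the inserted vector itself is an admissible wedge sum
        exact ⟨insM printFact_unitaryCompact_holds _ c.D.jT₃₄ core.kind core.lam core.hlam _ _ core.side f (PiTensorProduct.tprod ℂ m),
          by rw [val_insM]; exact hmatched χ f m cχ hcχ hmt, rfl⟩
      · -- unmatched: zero period
        simp only [not_forall] at hmt
        obtain ⟨t, ht⟩ := hmt
        refine ⟨0, by rw [WeilThetaModel.coe_zero]; exact Submodule.zero_mem _, ?_⟩
        rw [t34_ϑ_zero hHD hI h₁ h₃ h hA (Gen12Pins.Wg @hGR @η @hη @hηc @Gen12Pins.τSyl @Gen12Pins.TSyl @Gen12Pins.hTSyl) (SInstance.SGP @G @hG @hGR @η @hη @hηc @hGR₀ @hGR₁ @hGR₂ @hGR₃ @AG) μ V c hW χ]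
        exact t34_ϑ_eq_zero_of_eigen hHD hI h₁ h₃ h hA (Gen12Pins.Wg @hGR @η @hη @hηc @Gen12Pins.τSyl @Gen12Pins.TSyl @Gen12Pins.hTSyl) (SInstance.SGP @G @hG @hGR @η @hη @hηc @hGR₀ @hGR₁ @hGR₂ @hGR₃ @AG) μ V c hW χ _ _ (∏ b, cχ b (t b))
          (by rw [val_insM]; exact heig m cχ hcχ t) ht
    | zero => exact ⟨0, by rw [WeilThetaModel.coe_zero]; exact Submodule.zero_mem _, by rw [map_zero]⟩
    | add x y _ _ hx hy =>
      obtain ⟨Ψ₁, hΨ₁, h₁'⟩ := hx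
      obtain ⟨Ψ₂, hΨ₂, h₂'⟩ := hy
      refine ⟨Ψ₁ + Ψ₂, by rw [WeilThetaModel.coe_add]; exact Submodule.add_mem _ hΨ₁ hΨ₂, ?_⟩
      rw [map_add, t34_ϑ_add hHD hI h₁ h₃ h hA (Gen12Pins.Wg @hGR @η @hη @hηc @Gen12Pins.τSyl @Gen12Pins.TSyl @Gen12Pins.hTSyl) (SInstance.SGP @G @hG @hGR @η @hη @hηc @hGR₀ @hGR₁ @hGR₂ @hGR₃ @AG) μ V c hW χ, t34_ϑ_add hHD hI h₁ h₃ h hA (Gen12Pins.Wg @hGR @η @hη @hηc @Gen12Pins.τSyl @Gen12Pins.TSyl @Gen12Pins.hTSyl) (SInstance.SGP @G @hG @hGR @η @hη @hηc @hGR₀ @hGR₁ @hGR₂ @hGR₃ @AG) μ V c hW χ, h₁', h₂']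
    | smul a x _ hx =>
      obtain ⟨Ψ, hΨ, h'⟩ := hx
      refine ⟨a • Ψ, by rw [WeilThetaModel.coe_smul]; exact Submodule.smul_mem _ a hΨ, ?_⟩
      rw [map_smul, t34_ϑ_smul hHD hI h₁ h₃ h hA (Gen12Pins.Wg @hGR @η @hη @hηc @Gen12Pins.τSyl @Gen12Pins.TSyl @Gen12Pins.hTSyl) (SInstance.SGP @G @hG @hGR @η @hη @hηc @hGR₀ @hGR₁ @hGR₂ @hGR₃ @AG) μ V c hW χ, t34_ϑ_smul hHD hI h₁ h₃ h hA (Gen12Pins.Wg @hGR @η @hη @hηc @Gen12Pins.τSyl @Gen12Pins.TSyl @Gen12Pins.hTSyl) (SInstance.SGP @G @hG @hGR @η @hη @hηc @hGR₀ @hGR₁ @hGR₂ @hGR₃ @AG) μ V c hW χ, h']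
  -- (iii) eigen pure tensors span the printed module
  exact key φ (Submodule.eq_top_iff'.mp (span_tprod_of_span_eq_top _ hspan) φ)

end Context34

end Gen12PinsP

end HodgeCM.Model

end
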